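import Summits.QuantumFields.YangMills.Theorems.UnitScaleTiltProp7IterLinStructureRec
import Literature.MathematicalPhysics.QuantumFieldTheory.Balaban1983to89.BlockAveragingEMLProp2
import Literature.MathematicalPhysics.QuantumFieldTheory.Balaban1983to89.LatticeWordStokes
import Literature.MathematicalPhysics.QuantumFieldTheory.Balaban1983to89.TorusGeometry
import HarnessLib

/-!
# Route `UnitScaleTilt`, crux K1 «MinimiserStabilityRegPr» (stmt-QuantumFields-19200), route-R [RP] at a curved background — THE CURVED N6,
# ROW (R-B) OF `CURVED-N6-LOCATED-w2g2.md`, PART 1: PROPAGATION OF PER-LEVEL BOUNDS ALONG THE RECURSION OF THE COARSE GAUGE FUNCTION `Λ`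
# (per site AND `ℓ²`-Minkowski over the levels), AND THE PER-LEVEL REGULARITY OF THE BACKGROUND TOWER ([B7] Prop. 2 (53)) READ INTO THE
# GUARDS OF THE CURVED ONE-STEP LETTERS (the «(43)-per-level supplier junction» of W-SEAT MAP pass #3 row M9)

Cell `ym3-torus`, D-0154 (3c) R3 twin-width seat `ym-routeR-w2` (W-SEAT MAP pass #3 row M9 as re-aimed by ★★OWNER g25 03:30:47Z ∕ 03:36:07Z:
«(R-B) instantiation + the (43)-per-level supplier junction»).  THEOREMS ONLY (0 `def`, 0 `sorry`); `--supports stmt-QuantumFields-19200`, count-neutral.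
YM₃ on T³ is a ladder rung (R3), not the Clay problem; nothing here claims the curved N6 bound, S2, P, the crux or the gap.

WHY (consumer: ✓ p601741 `Prop7CurvedLandauCoercivity.sum_normSq_le_curl_sq_of_landau_of_structure_T3`, displayed row `hΛ : Σ_y ‖Λ y‖² ≤ c_Λ·L^k·G`).
The curved structure theorem (bricks 1–5, ✓ p602235 … ✓ p605789; (R-A) in flight) splits the `k`-fold true linearisation of the symmetric average at
the background tower `Ū₀^{(j)} = Averaging.iter (blockAvg expMeanLogSU) j U₀` as `T^{(j)}Y = G_j + P_{Ū₀^{(j)}}Λ_j`, with the recursion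
`Λ_{j+1}(z) = CM_j(G_j)(z) + Λ_j(emb z)` (`CM_j` the covariant comb mean of brick 1).  The `(H¹)^*`-bound of `Λ_k` is obtained level by level; this file
supplies the representation-independent propagation and the tower regularity the per-level letters are guarded by.
* §1 PROPAGATION.  (a) per site (covariant twin of `Prop7IterLambdaBound.norm_iterLambda_le_of_range`, for ANY seminormed target and ANY recursion with
  `‖Λ_{j+1}(z)‖ ≤ ‖M_j(z)‖ + ‖Λ_j(emb z)‖` — satisfied by the plain recursion and by a unitarily transported one); (b) `ℓ²`-MINKOWSKI over the levels:
  `√(Σ_y ‖Λ_k(y)‖²) ≤ Σ_{j<k} √(Σ_z t_j(z)²)` whenever `‖Λ_{j+1}(z)‖ ≤ t_j(z) + ‖Λ_j(emb z)‖` (triangle inequality in `ℓ²` + injectivity of `emb`) — the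
  form in which per-level constants do NOT compound (the squared route costs `2^k`), with the geometric specialisation `√(Σ t_j²) ≤ A(√L)^j R ⇒
  Σ_y‖Λ_k y‖² ≤ A²·(L^k/(√L−1)²)·R²` — exactly the `c_Λ·L^k·G` shape of the consumer's `hΛ`.
* §2 THE TOWER JUNCTION (risk (ii) of the memo).  From `PlaqSmall (ε(L^k)⁻²) U₀` and the two numerical conditions of [B7] Prop. 2: every level background
  `Ū₀^{(j)}`, `j ≤ k`, has plaquette variables `< 2ε(L^j/L^k)² ≤ 2ε` (`BlockAveragingEMLProp2.plaqSmall_iter_blockAvg_eml_level`, the tower term being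
  LITERALLY the one of ✓ p605789), and the (0.4) guards `dist1(W^{(j)}_i(c)) < δ_N` (`j < k`) of ✓ p603693 ∕ ✓ p605789 hold — their `hg` binder discharged;
  also from the route's non-strict (14)-type bound.
The covariant CENTRING of the comb mean (the per-level oscillation-to-comb step, with abstract reference frames) is the companion file
`UnitScaleTiltProp7CovCombMeanCentred`.

HONEST SCOPE.  Bookkeeping, the triangle inequality, and two tree estimates read by name; the per-level oscillation bound (covariant Poincaré on `B(z)` at
level `j`) and the one-step gradient transfer are the next files.  Nothing of Bałaban's analysis is asserted beyond the cited tree theorems.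

References: T. Bałaban, CMP 95 (1984) 17–40 [Balaban1984PropagatorsI] ((1.18)–(1.20) pp.19–20); CMP 98 (1985) 17–51 [Balaban1985Averaging] (Prop. 2 (52)–(54)
p.26); CMP 109 (1987) 249–301 [Balaban1987RG1] ((0.4) p.253); CMP 102 (1985) 277–309 [Balaban1985Variational] ((14) p.280, Prop. 7 p.299).
-/

noncomputable section

open scoped BigOperators Matrix.Norms.L2Operator

namespace Summit.QuantumFields.YangMills.Theorems.Prop7CovIterLambdaBound

open Literature.MathematicalPhysics.QuantumFieldTheory.Balaban1983to89
open Finset T4Continuum BlockAveraging AveragingRT ExpMeanLog BlockAveragingEMLProp2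
open Summit.QuantumFields.YangMills.Theorems.Prop7IterLinStructureRec (geom_sum_sqrt_le)

variable {P : Params}

/-! ## §1 Propagation of per-level bounds along the recursion -/

section Propagation

variable {M : Type*} [SeminormedAddCommGroup M]

/-- **PROPAGATION, PER SITE** (covariant twin of `Prop7IterLambdaBound.norm_iterLambda_le_of_range`): for a family `Λ` with `Λ_0 = 0` and
`‖Λ_{k+1}(y)‖ ≤ ‖M_k(y)‖ + ‖Λ_k(emb y)‖` (any recursion `Λ_{k+1}(y) = M_k(y) + (transport of) Λ_k(emb y)` with a norm-preserving transport), per-level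
bounds `‖M_k(y)‖ ≤ a_k·G_{k+1}(y)` against a block functional monotone along the nesting propagate to `‖Λ_k(y)‖ ≤ (Σ_{j<k} a_j)·G_k(y)` (`k ≤ K₀`).
[cite: Balaban1984PropagatorsI, (1.18)-(1.20) pp.19-20] -/
theorem norm_covIterLambda_le_of_range (Λ : (k : ℕ) → Site P k → M) (hΛ0 : ∀ y, Λ 0 y = 0) (T : (k : ℕ) → Site P (k + 1) → M)
    (hΛs : ∀ (k : ℕ) (y : Site P (k + 1)), ‖Λ (k + 1) y‖ ≤ ‖T k y‖ + ‖Λ k (emb y)‖)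
    (K₀ : ℕ) (a : ℕ → ℝ) (ha : ∀ j, 0 ≤ a j) (G : (k : ℕ) → Site P k → ℝ)
    (hG : ∀ (k : ℕ) (y : Site P (k + 1)), k + 1 ≤ K₀ → G k (emb y) ≤ G (k + 1) y)
    (hlev : ∀ (k : ℕ) (y : Site P (k + 1)), k + 1 ≤ K₀ → ‖T k y‖ ≤ a k * G (k + 1) y) :
    ∀ (k : ℕ), k ≤ K₀ → ∀ (y : Site P k), ‖Λ k y‖ ≤ (∑ j ∈ Finset.range k, a j) * G k y := by
  intro k
  induction k with
  | zero => intro _ y; simp [hΛ0]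
  | succ k ih =>
    intro hk y
    have hsum : 0 ≤ ∑ j ∈ Finset.range k, a j := Finset.sum_nonneg fun j _ => ha j
    rw [Finset.sum_range_succ]
    calc ‖Λ (k + 1) y‖ ≤ ‖T k y‖ + ‖Λ k (emb y)‖ := hΛs k y
      _ ≤ a k * G (k + 1) y + (∑ j ∈ Finset.range k, a j) * G k (emb y) := add_le_add (hlev k y hk) (ih (Nat.le_of_succ_le hk) (emb y))
      _ ≤ a k * G (k + 1) y + (∑ j ∈ Finset.range k, a j) * G (k + 1) y := by
          have := mul_le_mul_of_nonneg_left (hG k y hk) hsum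
          linarith
      _ = (∑ j ∈ Finset.range k, a j + a k) * G (k + 1) y := by ring

/-- The plain recursion `Λ_{k+1}(y) = M_k(y) + Λ_k(emb y)` satisfies the propagation hypothesis. [folklore] -/
theorem norm_le_of_rec_eq (Λ : (k : ℕ) → Site P k → M) (T : (k : ℕ) → Site P (k + 1) → M)
    (hΛs : ∀ (k : ℕ) (y : Site P (k + 1)), Λ (k + 1) y = T k y + Λ k (emb y)) :
    ∀ (k : ℕ) (y : Site P (k + 1)), ‖Λ (k + 1) y‖ ≤ ‖T k y‖ + ‖Λ k (emb y)‖ := fun k y => by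
  rw [hΛs]; exact norm_add_le _ _

end Propagation

section PropagationConj

variable {n : Type*} [Fintype n] [DecidableEq n] [Nonempty n]

/-- Conjugation by a special-unitary matrix does not increase the operator norm. [folklore] -/
theorem norm_conj_su_le (u : Matrix.specialUnitaryGroup n ℂ) (X : Matrix n n ℂ) :
    ‖(u : Matrix n n ℂ) * X * star (u : Matrix n n ℂ)‖ ≤ ‖X‖ := by
  have hu : ‖(u : Matrix n n ℂ)‖ = 1 := CStarRing.norm_of_mem_unitary (Matrix.mem_specialUnitaryGroup_iff.1 u.2).1
  have hus : ‖star (u : Matrix n n ℂ)‖ = 1 := by rw [norm_star, hu]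
  calc ‖(u : Matrix n n ℂ) * X * star (u : Matrix n n ℂ)‖ ≤ ‖(u : Matrix n n ℂ)‖ * ‖X‖ * ‖star (u : Matrix n n ℂ)‖ :=
        (norm_mul_le _ _).trans (mul_le_mul_of_nonneg_right (norm_mul_le _ _) (norm_nonneg _))
    _ = ‖X‖ := by rw [hu, hus, one_mul, mul_one]

/-- The transported recursion `Λ_{k+1}(y) = M_k(y) + u·Λ_k(emb y)·u*` (`u` special unitary, e.g. a background bond or comb variable) satisfies the
propagation hypothesis. [folklore] -/
theorem norm_le_of_rec_conj (Λ : (k : ℕ) → Site P k → Matrix n n ℂ) (T : (k : ℕ) → Site P (k + 1) → Matrix n n ℂ)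
    (u : (k : ℕ) → Site P (k + 1) → Matrix.specialUnitaryGroup n ℂ)
    (hΛs : ∀ (k : ℕ) (y : Site P (k + 1)),
      Λ (k + 1) y = T k y + ((u k y : Matrix.specialUnitaryGroup n ℂ) : Matrix n n ℂ) * Λ k (emb y) * star ((u k y : Matrix.specialUnitaryGroup n ℂ) : Matrix n n ℂ)) :
    ∀ (k : ℕ) (y : Site P (k + 1)), ‖Λ (k + 1) y‖ ≤ ‖T k y‖ + ‖Λ k (emb y)‖ := fun k y => by
  rw [hΛs]
  exact (norm_add_le _ _).trans (add_le_add le_rfl (norm_conj_su_le _ _))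

end PropagationConj

/-! ### §1b `ℓ²`-Minkowski over the levels -/

section Minkowski

variable {M : Type*} [SeminormedAddCommGroup M]

/-- Minkowski for finite sums of nonnegative reals: `√(Σ (a+b)²) ≤ √(Σ a²) + √(Σ b²)`. [folklore] -/
theorem sqrt_sum_sq_add_le {ι : Type*} (s : Finset ι) (a b : ι → ℝ) (ha : ∀ i ∈ s, 0 ≤ a i) (hb : ∀ i ∈ s, 0 ≤ b i) :
    Real.sqrt (∑ i ∈ s, (a i + b i) ^ 2) ≤ Real.sqrt (∑ i ∈ s, a i ^ 2) + Real.sqrt (∑ i ∈ s, b i ^ 2) := by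
  set A : ℝ := ∑ i ∈ s, a i ^ 2 with hA
  set B : ℝ := ∑ i ∈ s, b i ^ 2 with hB
  have hA0 : 0 ≤ A := Finset.sum_nonneg fun i _ => sq_nonneg _
  have hB0 : 0 ≤ B := Finset.sum_nonneg fun i _ => sq_nonneg _
  have hcs : (∑ i ∈ s, a i * b i) ^ 2 ≤ A * B := Finset.sum_mul_sq_le_sq_mul_sq s a b
  have hab0 : 0 ≤ ∑ i ∈ s, a i * b i := Finset.sum_nonneg fun i hi => mul_nonneg (ha i hi) (hb i hi)
  have hcs' : ∑ i ∈ s, a i * b i ≤ Real.sqrt A * Real.sqrt B := by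
    rw [← Real.sqrt_mul hA0, ← Real.sqrt_sq hab0]
    exact Real.sqrt_le_sqrt hcs
  have hexp : ∑ i ∈ s, (a i + b i) ^ 2 = A + 2 * ∑ i ∈ s, a i * b i + B := by
    rw [hA, hB, Finset.mul_sum, ← Finset.sum_add_distrib, ← Finset.sum_add_distrib]
    exact Finset.sum_congr rfl fun i _ => by ring
  have hrhs0 : 0 ≤ Real.sqrt A + Real.sqrt B := add_nonneg (Real.sqrt_nonneg _) (Real.sqrt_nonneg _)
  rw [← Real.sqrt_sq hrhs0]
  refine Real.sqrt_le_sqrt ?_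
  rw [hexp, add_sq, Real.sq_sqrt hA0, Real.sq_sqrt hB0]
  nlinarith [hcs']

/-- A sum of nonnegative terms over the centres `emb z` is at most the sum over all fine sites (`emb` is injective in the standing range). [folklore] -/
theorem sum_comp_emb_le {k : ℕ} (hk : k + 1 ≤ P.m + P.K) (f : Site P k → ℝ) (hf : ∀ y, 0 ≤ f y) :
    ∑ z : Site P (k + 1), f (emb z) ≤ ∑ y : Site P k, f y := by
  have hinj : Function.Injective (emb : Site P (k + 1) → Site P k) := fun z z' h => by
    rw [← Site.blockOf_emb hk z, ← Site.blockOf_emb hk z', h]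
  rw [← Finset.sum_image (f := f) (fun z _ z' _ h => hinj h)]
  exact Finset.sum_le_sum_of_subset_of_nonneg (Finset.subset_univ _) fun y _ _ => hf y

/-- **PROPAGATION IN `ℓ²` — MINKOWSKI OVER THE LEVELS**: if `Λ_0 = 0` and `‖Λ_{j+1}(z)‖ ≤ t_j(z) + ‖Λ_j(emb z)‖` with `t_j ≥ 0`, then for `k ≤ m + K`
`√(Σ_{y ∈ T^{(k)}} ‖Λ_k(y)‖²) ≤ Σ_{j<k} √(Σ_{z ∈ T^{(j+1)}} t_j(z)²)` — the per-level `ℓ²` sizes ADD (no compounding of constants), because along the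
recursion each level-`k` site reads the per-level terms at its own chain of centres and `emb` is injective. [cite: Balaban1984PropagatorsI, (1.18)-(1.20) pp.19-20] -/
theorem sqrt_sum_normSq_le_sum_levels (Λ : (k : ℕ) → Site P k → M) (hΛ0 : ∀ y, Λ 0 y = 0) (t : (k : ℕ) → Site P (k + 1) → ℝ)
    (ht : ∀ k z, 0 ≤ t k z) (hΛs : ∀ (k : ℕ) (z : Site P (k + 1)), ‖Λ (k + 1) z‖ ≤ t k z + ‖Λ k (emb z)‖) :
    ∀ k : ℕ, k ≤ P.m + P.K → Real.sqrt (∑ y : Site P k, ‖Λ k y‖ ^ 2) ≤ ∑ j ∈ Finset.range k, Real.sqrt (∑ z : Site P (j + 1), t j z ^ 2) := by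
  intro k
  induction k with
  | zero => intro _; simp [hΛ0]
  | succ k ih =>
    intro hk
    rw [Finset.sum_range_succ]
    have hk' : k ≤ P.m + P.K := Nat.le_of_succ_le hk
    -- pointwise bound, then Minkowski, then injectivity of `emb`
    have h1 : Real.sqrt (∑ z : Site P (k + 1), ‖Λ (k + 1) z‖ ^ 2)
        ≤ Real.sqrt (∑ z : Site P (k + 1), (t k z + ‖Λ k (emb z)‖) ^ 2) :=
      Real.sqrt_le_sqrt (Finset.sum_le_sum fun z _ => pow_le_pow_left₀ (norm_nonneg _) (hΛs k z) 2)
    have h2 := sqrt_sum_sq_add_le (Finset.univ : Finset (Site P (k + 1))) (fun z => t k z) (fun z => ‖Λ k (emb z)‖)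
      (fun z _ => ht k z) (fun z _ => norm_nonneg _)
    have h3 : Real.sqrt (∑ z : Site P (k + 1), ‖Λ k (emb z)‖ ^ 2) ≤ Real.sqrt (∑ y : Site P k, ‖Λ k y‖ ^ 2) :=
      Real.sqrt_le_sqrt (sum_comp_emb_le hk (fun y => ‖Λ k y‖ ^ 2) fun y => sq_nonneg _)
    linarith [ih hk']

/-- **SQUARED FORM WITH GEOMETRIC PER-LEVEL SIZES** (`d = 3` bookkeeping of the k-uniformity): if moreover `√(Σ_z t_j(z)²) ≤ A·(√L)^j·R` for `j < k` with
`A, R ≥ 0`, then `Σ_y ‖Λ_k(y)‖² ≤ A²·(L^k/(√L − 1)²)·R²` (`Σ_{j<k}(√L)^j ≤ (√L)^k/(√L−1)`). [cite: Balaban1984PropagatorsI, (1.18)-(1.20) pp.19-20] -/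
theorem sum_normSq_le_geom (Λ : (k : ℕ) → Site P k → M) (hΛ0 : ∀ y, Λ 0 y = 0) (t : (k : ℕ) → Site P (k + 1) → ℝ)
    (ht : ∀ k z, 0 ≤ t k z) (hΛs : ∀ (k : ℕ) (z : Site P (k + 1)), ‖Λ (k + 1) z‖ ≤ t k z + ‖Λ k (emb z)‖)
    {k : ℕ} (hk : k ≤ P.m + P.K) {A R : ℝ} (hA : 0 ≤ A) (hR : 0 ≤ R)
    (hlev : ∀ j < k, Real.sqrt (∑ z : Site P (j + 1), t j z ^ 2) ≤ A * Real.sqrt P.L ^ j * R) :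
    ∑ y : Site P k, ‖Λ k y‖ ^ 2 ≤ A ^ 2 * ((P.L : ℝ) ^ k / (Real.sqrt P.L - 1) ^ 2) * R ^ 2 := by
  have hL1 : (1 : ℝ) < (P.L : ℝ) := by exact_mod_cast P.hL.2
  have hL0 : (0 : ℝ) ≤ (P.L : ℝ) := Nat.cast_nonneg _
  have hs : 0 < Real.sqrt P.L - 1 := by
    rw [sub_pos, show (1 : ℝ) = Real.sqrt 1 from Real.sqrt_one.symm]
    exact Real.sqrt_lt_sqrt zero_le_one hL1
  have hmain := sqrt_sum_normSq_le_sum_levels Λ hΛ0 t ht hΛs k hk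
  have hsum : ∑ j ∈ Finset.range k, Real.sqrt (∑ z : Site P (j + 1), t j z ^ 2) ≤ A * (Real.sqrt P.L ^ k / (Real.sqrt P.L - 1)) * R := by
    calc ∑ j ∈ Finset.range k, Real.sqrt (∑ z : Site P (j + 1), t j z ^ 2)
        ≤ ∑ j ∈ Finset.range k, A * Real.sqrt P.L ^ j * R := Finset.sum_le_sum fun j hj => hlev j (Finset.mem_range.mp hj)
      _ = A * (∑ j ∈ Finset.range k, Real.sqrt P.L ^ j) * R := by rw [Finset.mul_sum, Finset.sum_mul]
      _ ≤ A * (Real.sqrt P.L ^ k / (Real.sqrt P.L - 1)) * R :=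
          mul_le_mul_of_nonneg_right (mul_le_mul_of_nonneg_left (geom_sum_sqrt_le hL1 k) hA) hR
  have hS0 : 0 ≤ ∑ y : Site P k, ‖Λ k y‖ ^ 2 := Finset.sum_nonneg fun y _ => sq_nonneg _
  have hT0 : 0 ≤ A * (Real.sqrt P.L ^ k / (Real.sqrt P.L - 1)) * R := by positivity
  have hsq := pow_le_pow_left₀ (Real.sqrt_nonneg _) (hmain.trans hsum) 2
  rw [Real.sq_sqrt hS0] at hsq
  refine hsq.trans (le_of_eq ?_)
  rw [mul_pow, mul_pow, div_pow, ← pow_mul, show Real.sqrt (P.L : ℝ) ^ (k * 2) = (P.L : ℝ) ^ k by rw [mul_comm, pow_mul, Real.sq_sqrt hL0]]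

end Minkowski

/-! ## §2 The tower junction: per-level regularity of the background tower ([B7] Prop. 2 (53)) and the guards of the one-step letters -/

section Tower

variable {n : Type*} [Fintype n] [DecidableEq n] [Nonempty n]

/-- From a non-strict plaquette bound below a strict threshold to `PlaqSmall` (bookkeeping for the (14)-type hypotheses of the route, which are
non-strict). [folklore] -/
theorem plaqSmall_of_le_of_lt {j : ℕ} {U : GaugeField P j (Matrix.specialUnitaryGroup n ℂ)} {a δ : ℝ}
    (hU : ∀ q : Plaq P j, dist1 (GaugeField.plaqHol U q) ≤ a) (haδ : a < δ) : PlaqSmall δ U :=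
  fun q => (hU q).trans_lt haδ

/-- **THE LEVEL BACKGROUNDS OF THE TOWER ARE REGULAR, UNIFORMLY IN THE LEVEL** ([B7] Prop. 2 (53), tree `plaqSmall_iter_blockAvg_eml_level`, read for the
tower term of the curved one-step letters): from `PlaqSmall (ε(L^k)⁻²) U₀`, `0 < ε`, `C₀(d)ε ≤ 1/3`, `2ε ≤ 2δ_N/((d+4)L)²`, every `Ū₀^{(j)}`, `j ≤ k`, has plaquette
variables `< 2ε(L^j/L^k)²`, in particular `< 2ε`. [cite: Balaban1985Averaging, Prop. 2 (53) p.26] -/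
theorem tower_plaq_lt (k : ℕ) {ε : ℝ} (hε : 0 < ε)
    (hε3 : (143 * ((((P.d + 4 : ℕ) : ℝ)) ^ 2 / 4) ^ 2) * ε ≤ 1 / 3)
    (hε2 : 2 * ε ≤ 2 * deltaSU n / (((P.d + 4) * P.L : ℕ) : ℝ) ^ 2)
    {U₀ : GaugeField P 0 (Matrix.specialUnitaryGroup n ℂ)} (hU : PlaqSmall (ε * (((P.L : ℝ) ^ k)⁻¹) ^ 2) U₀) {j : ℕ} (hj : j ≤ k)
    (q : Plaq P j) :
    dist1 (GaugeField.plaqHol (Averaging.iter (fun i => blockAvg (P := P) (j := i) (expMeanLogSU (n := n))) j U₀) q)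
        < 2 * ε * ((P.L : ℝ) ^ j * ((P.L : ℝ) ^ k)⁻¹) ^ 2 ∧
      dist1 (GaugeField.plaqHol (Averaging.iter (fun i => blockAvg (P := P) (j := i) (expMeanLogSU (n := n))) j U₀) q) < 2 * ε := by
  have h := plaqSmall_iter_blockAvg_eml_level (n := n) k hε hε3 hε2 hU hj q
  refine ⟨h, h.trans_le ?_⟩
  have hLpos : (0 : ℝ) < (P.L : ℝ) ^ k := by have := P.L_pos; positivity
  have hx1 : (P.L : ℝ) ^ j * ((P.L : ℝ) ^ k)⁻¹ ≤ 1 := by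
    rw [mul_inv_le_iff₀ hLpos, one_mul]
    exact pow_le_pow_right₀ (by exact_mod_cast P.L_pos) hj
  have hx0 : 0 ≤ (P.L : ℝ) ^ j * ((P.L : ℝ) ^ k)⁻¹ := by positivity
  have hsq : ((P.L : ℝ) ^ j * ((P.L : ℝ) ^ k)⁻¹) ^ 2 ≤ 1 := by nlinarith
  nlinarith

/-- ★ **THE GUARDS OF THE CURVED ONE-STEP LETTERS HOLD ALONG THE TOWER** (the `hg` binder of ✓ p603693 `Prop7TrueLinPureGauge.trueLin_pureGauge` ∕ ✓ p605789
`Prop7TrueLinPureGaugeIter.trueLinIter_pureGauge`, discharged): under the hypotheses of `tower_plaq_lt`, for every `j < k` every (0.4) loop variable of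
`Ū₀^{(j)}` is within `δ_N` of `1` — `dist1(W^{(j)}_i(c)) ≤ (((d+2)L)²/4)·2ε < ((d+4)L)²·ε ≤ δ_N` (`dist1_loopHol_le'`). [cite: Balaban1987RG1, (0.4) p.253;
Balaban1985Averaging, Prop. 2 (53) p.26] -/
theorem tower_guard (k : ℕ) {ε : ℝ} (hε : 0 < ε)
    (hε3 : (143 * ((((P.d + 4 : ℕ) : ℝ)) ^ 2 / 4) ^ 2) * ε ≤ 1 / 3)
    (hε2 : 2 * ε ≤ 2 * deltaSU n / (((P.d + 4) * P.L : ℕ) : ℝ) ^ 2)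
    {U₀ : GaugeField P 0 (Matrix.specialUnitaryGroup n ℂ)} (hU : PlaqSmall (ε * (((P.L : ℝ) ^ k)⁻¹) ^ 2) U₀) :
    ∀ j < k, ∀ (c : PBond P (j + 1)) (i : Idx P),
      dist1 (loopHol (Averaging.iter (fun i => blockAvg (P := P) (j := i) (expMeanLogSU (n := n))) j U₀) c i) < deltaSU n := by
  intro j hj c i
  have hplaq : ∀ q : Plaq P j, dist1 (GaugeField.plaqHol (Averaging.iter (fun i => blockAvg (P := P) (j := i) (expMeanLogSU (n := n))) j U₀) q) ≤ 2 * ε :=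
    fun q => ((tower_plaq_lt k hε hε3 hε2 hU hj.le q).2).le
  have h := dist1_loopHol_le' (by positivity) hplaq c i
  refine h.trans_lt ?_
  -- `((d+2)L)²/4 · 2ε < ((d+4)L)² · ε ≤ δ_N`
  have hD : (0 : ℝ) < (((P.d + 4) * P.L : ℕ) : ℝ) ^ 2 := by have := P.L_pos; positivity
  have hδ : (((P.d + 4) * P.L : ℕ) : ℝ) ^ 2 * ε ≤ deltaSU n := by
    have h2 : 2 * deltaSU n / (((P.d + 4) * P.L : ℕ) : ℝ) ^ 2 = 2 * (deltaSU n / (((P.d + 4) * P.L : ℕ) : ℝ) ^ 2) := by ring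
    rw [h2] at hε2
    have := (le_div_iff₀ hD).mp (by linarith : ε ≤ deltaSU n / (((P.d + 4) * P.L : ℕ) : ℝ) ^ 2)
    linarith
  have hlt : (((P.d + 2) * P.L : ℕ) : ℝ) ^ 2 / 4 * (2 * ε) < (((P.d + 4) * P.L : ℕ) : ℝ) ^ 2 * ε := by
    have h1 : (((P.d + 2) * P.L : ℕ) : ℝ) ^ 2 < (((P.d + 4) * P.L : ℕ) : ℝ) ^ 2 := by
      have hL : (0 : ℝ) < P.L := by exact_mod_cast P.L_pos
      have : (((P.d + 2) * P.L : ℕ) : ℝ) < (((P.d + 4) * P.L : ℕ) : ℝ) := by push_cast; nlinarith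
      exact pow_lt_pow_left₀ this (by positivity) two_ne_zero
    nlinarith
  linarith

/-- The same guards, stated from the route's non-strict (14)-type bound `dist1(U₀(∂p)) ≤ ε₀(L^k)⁻²` and any admissible `ε > ε₀`. [cite: Balaban1985Variational, (14) p.280] -/
theorem tower_guard_of_le (k : ℕ) {ε₀ ε : ℝ} (hε0 : ε₀ < ε) (hε : 0 < ε)
    (hε3 : (143 * ((((P.d + 4 : ℕ) : ℝ)) ^ 2 / 4) ^ 2) * ε ≤ 1 / 3)
    (hε2 : 2 * ε ≤ 2 * deltaSU n / (((P.d + 4) * P.L : ℕ) : ℝ) ^ 2)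
    {U₀ : GaugeField P 0 (Matrix.specialUnitaryGroup n ℂ)} (hU : ∀ p : Plaq P 0, dist1 (GaugeField.plaqHol U₀ p) ≤ ε₀ * (((P.L : ℝ) ^ k) ^ 2)⁻¹) :
    ∀ j < k, ∀ (c : PBond P (j + 1)) (i : Idx P),
      dist1 (loopHol (Averaging.iter (fun i => blockAvg (P := P) (j := i) (expMeanLogSU (n := n))) j U₀) c i) < deltaSU n := by
  refine tower_guard k hε hε3 hε2 (plaqSmall_of_le_of_lt hU ?_)
  have hLpos : (0 : ℝ) < ((P.L : ℝ) ^ k) ^ 2 := by have := P.L_pos; positivity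
  rw [inv_pow]
  exact mul_lt_mul_of_pos_right hε0 (inv_pos.mpr hLpos)

end Tower

end Summit.QuantumFields.YangMills.Theorems.Prop7CovIterLambdaBound

end
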